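import Summits.ValiantsHypothesis.ValiantsHypothesis.Theorems.BarrierLeverChowBenchmarkPairsDirichletPeel

/-!
# Route BarrierLever — item 22038 `ChowBenchmarkPairs`, line `moore-peel`: Dirichlet(α,α) poisedness at EVERY
# height for every NON-INTEGER RATIONAL parameter `α = p/q` (rational root theorem + LEMMA Z′)

Helper file (`--supports stmt-ValiantsHypothesis-22038`; cell valiant-natproofs, rung V4, 𝒟-side benchmark of
record, line `moore_peel`, card v12 (E)(iii) strengthened; seat val-np-p4 gen 26).  Closes NO item.  One definition
(`dirichletWeight p q`, the integer weight sequence `w_{p,q}(k) = p(p+q)(p+2q)⋯(p+(k-1)q) = q^k·α^{(k)}` of the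
Dirichlet parameter `α = p/q`; `q = 1`: `Nat.ascFactorial p`, `dirichletWeight_one`).

THEOREM (`kernelPoisedAt_dirichletWeight`).  If `q ∤ p` (`q ≠ 0`) then `KernelPoisedAt (dirichletWeight p q) h` for
ALL `h`: the Dirichlet(α,α)-weighted segment-moment matrix of the benchmark layout (`…KernelPoised`) is
nonsingular for some point table at every height, for EVERY positive rational non-integer `α` — e.g. the arcsine
law `α = 1/2`, weights `(2k-1)!!` (`kernelPoisedAt_arcsine`).  The line's open stub `stub_segmentMeanValue` is the
INTEGER parameter `α = 1` (uniform segment means), where the peel stops (`det G_183 = 0`).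

PROOF.  `det G^{(X)}_i ∈ ℤ[X]` (`dirichletPeelPoly`, file `…DirichletPeel`) has LEADING COEFFICIENT `det Z_i = ±1`
(`leadingCoeff_det_dirichletPeelPoly`: degree bound `natDegree_det_le_of_forall` for the rescaled matrix plus
`coeff_det_scaledDirichlet`; LEMMA Z′), so `det Z_i · det G^{(X)}_i` is monic and by the rational root theorem
(`isInteger_of_is_root_of_monic`, `ℤ ⊂ ℚ`) every rational root is an integer
(`exists_int_of_aeval_det_dirichletPeelPoly_eq_zero`).  The scaling identity
`diag(q^{|T_j|})·G^{w_{p,q}}_i = G^{(X)}_i(p/q)·diag(q^{|T_{c_i+m}|})` (`scaling_dirichletWeight`, from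
`cast_dirichletWeight : w_{p,q}(k) = q^k·(ascPochhammer ℤ k)(p/q)`) gives `det G^{w_{p,q}}_i ≠ 0` for every `i` when
`p/q ∉ ℤ` (`det_kpeelMatrix_dirichletWeight_ne_zero`); THEOREM A^κ (`kernelPoisedAt_of_kpeel`) concludes.

DATA (kit j321334, evidence on 22038): among the natural parameters `α ≤ 30` and stages `i ≤ 500` the ONLY singular
Dirichlet stage matrices are at `α = 1` (`i = 183, 364, 444`); unit weights: none (LEMMA Z′).  So within reach of
the computation `α = 1` is the unique bad positive rational parameter.

WHAT THIS IS NOT: nothing at `α = 1` — `stub_segmentMeanValue` stays open; nothing for integer `α ≥ 2` beyond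
`…DirichletPeel` (all but finitely many per height); nothing on crux stmt-ValiantsHypothesis-14610 or on `VP` versus
`VNP`.
-/

set_option linter.dupNamespace false

namespace Summit.ValiantsHypothesis.ValiantsHypothesis.Theorems.BarrierLever.MoorePeel

open Polynomial Finset
/-! ## 1. Degree bound for determinants of polynomial matrices -/

/-- If every entry of a square matrix over `R[X]` has degree `≤ d`, its determinant has degree `≤ N d`. -/
theorem natDegree_det_le_of_forall {R : Type*} [CommRing R] {ι : Type*} [Fintype ι] [DecidableEq ι]
    (M : Matrix ι ι R[X]) (d : ℕ) (hM : ∀ i j, (M i j).natDegree ≤ d) :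
    M.det.natDegree ≤ Fintype.card ι * d := by
  rw [Matrix.det_apply']
  refine Polynomial.natDegree_sum_le_of_forall_le _ _ fun σ _ => ?_
  have hsign : ((Equiv.Perm.sign σ : ℤ) : R[X]) = Polynomial.C ((Equiv.Perm.sign σ : ℤ) : R) := by
    simp
  rw [hsign]
  refine (natDegree_C_mul_le _ _).trans ((natDegree_prod_le _ _).trans ?_)
  calc ∑ k, (M (σ k) k).natDegree ≤ ∑ _k : ι, d := Finset.sum_le_sum fun k _ => hM _ _
    _ = Fintype.card ι * d := by rw [Finset.sum_const, smul_eq_mul, Finset.card_univ]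

/-! ## 2. `det G^{(X)}_i` is monic up to the sign `det Z_i` -/

/-- The rescaled determinant has degree `≤ iD` … -/
theorem natDegree_det_scaledDirichlet_le (i : ℕ) :
    (scaledDirichlet i).det.natDegree ≤ i * (windowStart i + i) := by
  have := natDegree_det_le_of_forall (scaledDirichlet i) _ (natDegree_scaledDirichlet_le i)
  rwa [Fintype.card_fin] at this

/-- … and leading coefficient `det Z_i`. -/
theorem leadingCoeff_det_scaledDirichlet (i : ℕ) :
    (scaledDirichlet i).det.leadingCoeff = (zetaPeelMatrix i).det := by
  have hle := natDegree_det_scaledDirichlet_le i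
  have hc := coeff_det_scaledDirichlet i
  have hne : (scaledDirichlet i).det.coeff (i * (windowStart i + i)) ≠ 0 := by
    rw [hc]; exact det_zetaPeelMatrix_ne_zero i
  rw [Polynomial.leadingCoeff, natDegree_eq_of_le_of_coeff_ne_zero hle hne, hc]

/-- **The leading coefficient of `det G^{(X)}_i` is `det Z_i = ±1`.** -/
theorem leadingCoeff_det_dirichletPeelPoly (i : ℕ) :
    (dirichletPeelPoly i).det.leadingCoeff = (zetaPeelMatrix i).det := by
  rw [← leadingCoeff_det_scaledDirichlet, det_scaledDirichlet, leadingCoeff_monic_mul (monic_X_pow _)]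

/-- `det Z_i · det Z_i = 1`. -/
theorem det_zetaPeelMatrix_mul_self (i : ℕ) :
    (zetaPeelMatrix i).det * (zetaPeelMatrix i).det = 1 := by
  rcases det_zetaWindow_eq_one_or i (windowStart i) with h1 | h1 <;>
    · rw [show zetaPeelMatrix i = zetaWindow i (windowStart i) from rfl, h1]; norm_num

/-- `det Z_i · det G^{(X)}_i` is MONIC. -/
theorem monic_signed_det_dirichletPeelPoly (i : ℕ) :
    (Polynomial.C (zetaPeelMatrix i).det * (dirichletPeelPoly i).det).Monic := by
  have hlc : (Polynomial.C (zetaPeelMatrix i).det).leadingCoeff *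
      (dirichletPeelPoly i).det.leadingCoeff = 1 := by
    rw [leadingCoeff_C, leadingCoeff_det_dirichletPeelPoly, det_zetaPeelMatrix_mul_self]
  rw [Monic, leadingCoeff_mul' (by rw [hlc]; exact one_ne_zero), hlc]

/-! ## 3. Rational roots of `det G^{(X)}_i` are integers (rational root theorem) -/

/-- **Every rational root of `det G^{(X)}_i` is an integer.** -/
theorem exists_int_of_aeval_det_dirichletPeelPoly_eq_zero (i : ℕ) {r : ℚ}
    (hr : Polynomial.aeval r (dirichletPeelPoly i).det = 0) : ∃ z : ℤ, (z : ℚ) = r := by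
  have hm := monic_signed_det_dirichletPeelPoly i
  have hr' : Polynomial.aeval r (Polynomial.C (zetaPeelMatrix i).det * (dirichletPeelPoly i).det) = 0 := by
    rw [map_mul, hr, mul_zero]
  have hint := isInteger_of_is_root_of_monic hm hr'
  rw [IsLocalization.IsInteger, RingHom.mem_rangeS] at hint
  obtain ⟨z, hz⟩ := hint
  exact ⟨z, by simpa using hz⟩

/-! ## 4. The weights `w_{p,q}(k) = ∏_{t<k} (p + tq)` (Dirichlet parameter `α = p/q`) -/

/-- The integer weight sequence of the Dirichlet parameter `α = p/q`: `w_{p,q}(k) = p(p+q)(p+2q)⋯(p+(k-1)q) =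
q^k · α(α+1)⋯(α+k-1)`.  (`q = 1`: `Nat.ascFactorial p`; `p = 1, q = 2`: the double factorials `(2k-1)!!` of the
arcsine law.) -/
def dirichletWeight (p q : ℕ) : ℕ → ℕ
  | 0 => 1
  | k + 1 => (p + k * q) * dirichletWeight p q k

/-- `w_{p,q}` has no zero when `p ≥ 1`. -/
theorem dirichletWeight_ne_zero {p : ℕ} (q : ℕ) (hp : p ≠ 0) : ∀ k, dirichletWeight p q k ≠ 0
  | 0 => by simp [dirichletWeight]
  | k + 1 => by
    rw [dirichletWeight]
    exact Nat.mul_ne_zero (by omega) (dirichletWeight_ne_zero q hp k)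

/-- `q = 1`: the rising factorials. -/
theorem dirichletWeight_one (p : ℕ) : ∀ k, dirichletWeight p 1 k = Nat.ascFactorial p k
  | 0 => by simp [dirichletWeight]
  | k + 1 => by rw [dirichletWeight, Nat.ascFactorial_succ, dirichletWeight_one p k, mul_one]

/-- `w_{p,q}(k) = q^k · (ascPochhammer ℤ k)(p/q)` in `ℚ` (`q ≠ 0`). -/
theorem cast_dirichletWeight (p q : ℕ) (hq : q ≠ 0) : ∀ k : ℕ,
    (dirichletWeight p q k : ℚ) = (q : ℚ) ^ k * Polynomial.aeval ((p : ℚ) / q) (ascPochhammer ℤ k)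
  | 0 => by simp [dirichletWeight]
  | k + 1 => by
    have hq' : (q : ℚ) ≠ 0 := by exact_mod_cast hq
    rw [dirichletWeight, Nat.cast_mul, cast_dirichletWeight p q hq k, ascPochhammer_succ_right, map_mul,
      map_add, Polynomial.aeval_X, map_natCast, pow_succ]
    field_simp
    push_cast
    ring

/-- **The scaling identity**: `diag(q^{|T_j|}) · G^{w_{p,q}}_i = G^{(X)}_i(p/q) · diag(q^{|T_{c_i+m}|})` over `ℚ`. -/
theorem scaling_dirichletWeight (p q : ℕ) (hq : q ≠ 0) (i : ℕ) :
    Matrix.diagonal (fun j : Fin i => ((q : ℚ)) ^ (bits (j : ℕ)).card) *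
        (kpeelMatrix (dirichletWeight p q) i).map (Int.cast : ℤ → ℚ) =
      (dirichletPeelPoly i).map (fun f => Polynomial.aeval ((p : ℚ) / q) f) *
        Matrix.diagonal (fun m : Fin i => ((q : ℚ)) ^ (bits (windowStart i + (m : ℕ))).card) := by
  ext j m
  rw [Matrix.diagonal_mul, Matrix.mul_diagonal, Matrix.map_apply, Matrix.map_apply, kpeelMatrix_eq_kincl,
    kincl, dirichletPeelPoly_apply]
  split_ifs with hsub
  · have hle : (bits (j : ℕ)).card ≤ (bits (windowStart i + (m : ℕ))).card := Finset.card_le_card hsub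
    rw [Int.cast_natCast, cast_dirichletWeight p q hq, ← mul_assoc, ← pow_add, Nat.add_sub_cancel' hle,
      mul_comm]
  · simp

/-- **For a NON-INTEGER rational parameter every Dirichlet stage matrix is nonsingular**: if `q ∤ p`
(`q ≥ 1`) then `det G^{w_{p,q}}_i ≠ 0` for EVERY `i` (rational root theorem + LEMMA Z′). -/
theorem det_kpeelMatrix_dirichletWeight_ne_zero (p q : ℕ) (hq : q ≠ 0) (hqp : ¬ q ∣ p) (i : ℕ) :
    (kpeelMatrix (dirichletWeight p q) i).det ≠ 0 := by
  intro h0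
  have hq' : (q : ℚ) ≠ 0 := by exact_mod_cast hq
  have e := congrArg Matrix.det (scaling_dirichletWeight p q hq i)
  rw [Matrix.det_mul, Matrix.det_mul, Matrix.det_diagonal, Matrix.det_diagonal] at e
  have hW : ((kpeelMatrix (dirichletWeight p q) i).map (Int.cast : ℤ → ℚ)).det = 0 := by
    have : ((kpeelMatrix (dirichletWeight p q) i).map (Int.castRingHom ℚ)).det = 0 := by
      rw [← RingHom.mapMatrix_apply, ← RingHom.map_det, h0, map_zero]
    exact this
  rw [hW, mul_zero] at e
  have hA : ((dirichletPeelPoly i).map (fun f => Polynomial.aeval ((p : ℚ) / q) f)).det = 0 := by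
    have hprod : (∏ m : Fin i, ((q : ℚ)) ^ (bits (windowStart i + (m : ℕ))).card) ≠ 0 :=
      Finset.prod_ne_zero_iff.mpr fun m _ => pow_ne_zero _ hq'
    exact (mul_eq_zero.mp e.symm).resolve_right hprod
  have hroot : Polynomial.aeval ((p : ℚ) / q) (dirichletPeelPoly i).det = 0 := by
    have : ((Polynomial.aeval ((p : ℚ) / q)).toRingHom.mapMatrix (dirichletPeelPoly i)).det = 0 := by
      rw [RingHom.mapMatrix_apply]
      exact hA
    rwa [← RingHom.map_det] at this
  obtain ⟨z, hz⟩ := exists_int_of_aeval_det_dirichletPeelPoly_eq_zero i hroot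
  apply hqp
  have hzq : (z : ℚ) * q = p := by rw [hz, div_mul_cancel₀ _ hq']
  have hzq' : z * (q : ℤ) = (p : ℤ) := by exact_mod_cast hzq
  exact Int.natCast_dvd_natCast.mp ⟨z, by rw [← hzq', mul_comm]⟩

/-- **Dirichlet poisedness at EVERY height for every non-integer rational parameter `α = p/q`** — e.g. the
arcsine law `α = 1/2` (weights `(2k-1)!!`): `KernelPoisedAt (dirichletWeight p q) h` for all `h` whenever `q ∤ p`.
The segment-mean stub of the line is the INTEGER parameter `α = 1`; integrality of the bad parameters is what
LEMMA Z′ (leading coefficient `±1`) forces. -/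
theorem kernelPoisedAt_dirichletWeight (p q : ℕ) (hq : q ≠ 0) (hqp : ¬ q ∣ p) (h : ℕ) :
    KernelPoisedAt (dirichletWeight p q) h :=
  kernelPoisedAt_of_kpeel (dirichletWeight p q)
    (dirichletWeight_ne_zero q (fun hp => hqp (hp ▸ dvd_zero q))) h
    fun i _ _ => det_kpeelMatrix_dirichletWeight_ne_zero p q hq hqp i

/-- The arcsine case `α = 1/2`: double-factorial-weighted segment moments are poised at every height. -/
theorem kernelPoisedAt_arcsine (h : ℕ) : KernelPoisedAt (dirichletWeight 1 2) h :=
  kernelPoisedAt_dirichletWeight 1 2 (by norm_num) (by norm_num) h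

end Summit.ValiantsHypothesis.ValiantsHypothesis.Theorems.BarrierLever.MoorePeel
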